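import Summits.QuantumFields.YangMills.Theorems.BalabanUVNodesN12TowerProxiesOfClass
import Summits.QuantumFields.YangMills.Theorems.BalabanUVNodesN12FlatHndRecordLetters

/-!
# DAG node N12 [B15] — THE PER-SITE GUARDED PROXIES OF A (2.12)-CLASS CONFIGURATION (LOCATED-HSB pen ρ5b §3b, asked by dag-n12-w6 ∕ dag-n12-d): the second proxy premise
# `hproxSite` of dag-n12-w6's `exists_rightInverse_letter_of_proxies` (p678596) — one guarded proxy per INNER `j`-site agreeing with `U₀` on the sharp towers of all rows touching it —
# READ OFF THE CLASS by the box lemma of `N12TowerProxiesOfClass` at the three-block box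

[Balaban1985Variational] = «[15]», (2) p. 278, (82)–(83) p. 290; [Balaban1988Convergent] = «[III]», (2.2) p. 255, (2.10)–(2.13) pp. 256–257; [Balaban1985Averaging] (19) p. 21.

Cell `pub-ymgap`, HUMAN RULINGS D-0062 ∕ D-0149, lane owner `pub-ymgap-dag-n12-c` (g21).  Key K1⁹ `stmt-QuantumFields-27364`, `--kind proof --supports … --as helper`; count-neutral.
NEW leaf; CONSUMED BY NAME: this lane's `N12TowerProxiesOfClass.exists_boxProxy_of_mem_class` ∕ `towerBox_lt_sitesPerDir` ∕ `boxSide_mul_eta_sq_le`, dag-n12-w6's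
`N12WindowNearRegionGeometry.boxPlaqs_subset_plaqsOf_topSeq_pred` ∕ `exists_offset_src_of_endpoint`, dag-n21's `N21ReadSetSupport.within_lift_of_blockIter_eq`, dag-n12-w3's
`N12FlatHndRecordLetters.blockIter_eq_iterBlockOf`.

WHAT.  ★★★ `siteProxies_Bj_of_mem_class` — for `U₀ ∈ U_k({Ω_j(Z)}, εreg)` (`k+1 ≤ m+K`, `4L ≤ M₁`, `LᵏM₁ ∣ 2L^{m+K}`, `0 ≤ εreg`, the radius letter `hsbU`, the floor `6(d−1)L·εreg ≤ ρ″`):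
`∀ j ∈ [1,k], ∀ y, ι_j y ∈ Ω_j(Z) → ∃ U′, (∀ c, (c₋ = y ∨ c₊ = y) → ∀ b₀, (B^j(b₀,₋) ∈ {c₋, c₊}) → (B^j(b₀,₊) ∈ {c₋, c₊}) → U′ b₀ = U₀ b₀) ∧ SmallBelow k U′` — p678596's `hproxSite`
VERBATIM.  The fine bonds in question lie in the coordinate box of radius `2Lʲ − 1` (+2) about `ι_j y` (their source block is `y` or a neighbour: `within_lift_of_blockIter_eq` +
`exists_offset_src_of_endpoint`, a deck translation), whose plaquettes sit in the class's level-`(j−1)` set (`boxPlaqs_subset_plaqsOf_topSeq_pred`, `4L ≤ M₁`); the box lemma does the rest.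
With ρ5b's `towerProxies_Bj_of_mem_class` (the per-bond premise) both proxy rows of p678596 are class-derived: `hsb` leaves the direct road (dag-n12-d's v9).

HONEST FRAMING.  Lattice bookkeeping over landed modules; radius `ρ″` ∃ per height; nothing of Bałaban's asserted; count-neutral helper; N12 NOT discharged; K1⁹ NOT closed; counts
unmoved; one finite 𝕋⁴ programme at fixed ε — R4 closes the conditional finite-𝕋⁴ rung `BalabanLadder.UV` only; NOT continuum ∕ OS ∕ mass gap ∕ Clay.
-/

noncomputable section

open scoped BigOperators Matrix.Norms.L2Operator Topology
open Filter Finset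

namespace Summit.QuantumFields.YangMills.BalabanUVNodes.N12SiteProxiesOfClass

open Literature.MathematicalPhysics.QuantumFieldTheory.Balaban1983to89
open T4Continuum (T4Family walkEnd)
open T4AdjointCovarianceUnitary (lieSU)
open B15DeterminingSets
open B14.Eq213MaximalDomains (side)
open B14.Eq213DetSet (Bj maxDomT)
open B14DomainGeom (Within)
open B15Eq112TorusCover (lift cover cover_lift)
open T4AxialGaugeSmallField (castSite boxPlaqs boxBonds)
open B7Prop1Explicit (e e_apply)
open B5Eq118OneStroke (iterBlockOf)
open T4ReflectionCone (three_le_L)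
open Node00
open Summit.QuantumFields.YangMills.BalabanUVNodes.N12WindowNearRegionGeometry (boxPlaqs_subset_plaqsOf_topSeq_pred exists_offset_src_of_endpoint)
open Summit.QuantumFields.YangMills.Theorems.N21ReadSetSupport (within_lift_of_blockIter_eq blockIter_embIter)
open Summit.QuantumFields.YangMills.BalabanUVNodes.N12FlatHndRecordLetters (blockIter_eq_iterBlockOf)
open Summit.QuantumFields.YangMills.BalabanUVNodes.N12TowerProxiesOfClass (exists_boxProxy_of_mem_class towerBox_lt_sitesPerDir boxSide_mul_eta_sq_le)

variable {F : T4Family} {N : ℕ} [NeZero N]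

/-- **A FINE BOND WHOSE SOURCE BLOCK IS AN END OF A ROW TOUCHING `y` LIES IN THE THREE-BLOCK BOX about `ι_j y`** (radius `2Lʲ − 1`, +2): the source is within `Lʲ − 1` of its block centre, which is
within `Lʲ` of `ι_j y` modulo a deck translation that `castSite` forgets. [cite: Balaban1987RG1, (0.1) p.251; Balaban1988Convergent, (2.11) p.256] -/
theorem mem_boxBonds_of_block_row {P : Params} {j : ℕ} (hj : j ≤ P.m + P.K) (y : Site P j) (c : PBond P j) (hc : c.src = y ∨ c.tgt = y)
    (b₀ : PBond P 0) (hs : iterBlockOf j b₀.src = c.src ∨ iterBlockOf j b₀.src = c.tgt) :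
    b₀ ∈ (boxBonds (fun κ => (((embIter j y) κ).val : ℤ) - ((2 * P.L ^ j - 1 : ℕ) : ℤ))
      (fun κ => (((embIter j y) κ).val : ℤ) + ((2 * P.L ^ j - 1 : ℕ) : ℤ) + 2) : Set (PBond P 0)) := by
  -- the source block `y'` and its offset from `y`
  obtain ⟨y', hy', hoff⟩ : ∃ y' : Site P j, iterBlockOf j b₀.src = y' ∧
      ∀ ν, ∃ D : ℤ, |D| ≤ ((P.L ^ j : ℕ) : ℤ) ∧ embIter j y' ν = embIter j y ν + (D : ZMod (P.sitesPerDir 0)) := by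
    rcases hs with h | h
    · refine ⟨c.src, h, fun ν => ?_⟩
      rcases hc with hcy | hcy
      · exact ⟨0, by positivity, by rw [hcy]; simp⟩
      · obtain ⟨D, hD, hDeq⟩ := exists_offset_src_of_endpoint hj c (Or.inr rfl) ν
        exact ⟨D, hD, by rw [← hcy]; exact hDeq⟩
    · refine ⟨c.tgt, h, fun ν => ?_⟩
      rcases hc with hcy | hcy
      · obtain ⟨D, hD, hDeq⟩ := exists_offset_src_of_endpoint hj c (Or.inr rfl) ν
        refine ⟨-D, by rw [abs_neg]; exact hD, ?_⟩
        rw [← hcy, hDeq]; push_cast; ring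
      · exact ⟨0, by positivity, by rw [hcy]; simp⟩
  have hq : 1 ≤ P.L ^ j := Nat.one_le_pow _ _ P.L_pos
  -- the source is within `Lʲ − 1` of the centre of its block
  have hblk : B14.Eq22Determines.blockIter j b₀.src = B14.Eq22Determines.blockIter j (embIter j y') := by
    rw [blockIter_eq_iterBlockOf, blockIter_eq_iterBlockOf, hy', ← blockIter_eq_iterBlockOf, blockIter_embIter hj]
  have hW := within_lift_of_blockIter_eq hj hblk
  -- an integer representative of the source, coordinatewise within `2Lʲ − 1` of `ι_j y`
  choose D hD hDeq using hoff
  have hrep : ∀ ν, ∃ t : ℤ, (lift P (embIter j y') ν : ℤ) = lift P (embIter j y) ν + D ν + (P.sitesPerDir 0 : ℤ) * t := by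
    intro ν
    have h1 : (((lift P (embIter j y') ν : ℤ)) : ZMod (P.sitesPerDir 0)) = (((lift P (embIter j y) ν + D ν : ℤ)) : ZMod (P.sitesPerDir 0)) := by
      have e1 : (((lift P (embIter j y') ν : ℤ)) : ZMod (P.sitesPerDir 0)) = embIter j y' ν := by simp [lift]
      have e2 : (((lift P (embIter j y) ν : ℤ)) : ZMod (P.sitesPerDir 0)) = embIter j y ν := by simp [lift]
      rw [e1, hDeq ν]; push_cast; rw [e2]
    obtain ⟨t, ht⟩ := (ZMod.intCast_eq_intCast_iff_dvd_sub _ _ _).1 h1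
    exact ⟨-t, by linarith⟩
  choose t ht using hrep
  have hlift : ∀ (a : Site P 0) (ν : Fin P.d), lift P a ν = ((a ν).val : ℤ) := fun _ _ => rfl
  refine ⟨fun ν => lift P b₀.src ν - (P.sitesPerDir 0 : ℤ) * t ν, fun ν => ?_, fun ν => ?_, ?_⟩
  · have h := abs_le.1 (hW ν); have h2 := abs_le.1 (hD ν); have h3 := ht ν
    rw [hlift (embIter j y) ν] at h3
    show (((embIter j y) ν).val : ℤ) - ((2 * P.L ^ j - 1 : ℕ) : ℤ) ≤ lift P b₀.src ν - (P.sitesPerDir 0 : ℤ) * t ν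
    have hc2 : ((2 * P.L ^ j - 1 : ℕ) : ℤ) = 2 * ((P.L ^ j : ℕ) : ℤ) - 1 := by
      rw [Nat.cast_sub (by omega), Nat.cast_mul]; simp
    rw [hc2]; linarith [h.1, h.2, h2.1, h2.2]
  · have h := abs_le.1 (hW ν); have h2 := abs_le.1 (hD ν); have h3 := ht ν
    rw [hlift (embIter j y) ν] at h3
    show lift P b₀.src ν - (P.sitesPerDir 0 : ℤ) * t ν + (e b₀.dir : Fin P.d → ℤ) ν ≤ (((embIter j y) ν).val : ℤ) + ((2 * P.L ^ j - 1 : ℕ) : ℤ) + 2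
    have hc2 : ((2 * P.L ^ j - 1 : ℕ) : ℤ) = 2 * ((P.L ^ j : ℕ) : ℤ) - 1 := by
      rw [Nat.cast_sub (by omega), Nat.cast_mul]; simp
    have he : (e b₀.dir : Fin P.d → ℤ) ν ≤ 1 := by rw [e_apply]; split_ifs <;> norm_num
    rw [hc2]; linarith [h.1, h.2, h2.1, h2.2]
  · funext ν
    show b₀.src ν = (((lift P b₀.src ν - (P.sitesPerDir 0 : ℤ) * t ν : ℤ)) : ZMod (P.sitesPerDir 0))
    push_cast
    simp [lift]

/-- ★★★ **THE PER-SITE PROXIES OF `𝐁_k(Z)` FROM THE CLASS** — dag-n12-w6's `hproxSite` premise of `exists_rightInverse_letter_of_proxies` (p678596) VERBATIM: for `U₀ ∈ U_k({Ω_j(Z)}, εreg)`, every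
inner `j`-site `y` (`1 ≤ j ≤ k`, `ι_j y ∈ Ω_j(Z)`) admits `U′ = U₀` on every fine bond whose end blocks are ends of a row touching `y`, with `SmallBelow k U′` — the box lemma at the
three-block box about `ι_j y` (radius `2Lʲ − 1`, in the class's level-`(j−1)` set since `4L ≤ M₁`), budget `(d−1)·4Lʲ·εreg·η_{j−1}² ≤ 6(d−1)L·εreg ≤ ρ″`.
[cite: Balaban1985Variational, (2) p.278, (82)–(83) p.290; Balaban1988Convergent, (2.2) p.255, (2.11)–(2.13) pp.256–257; Balaban1985Averaging, (19) p.21] -/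
theorem siteProxies_Bj_of_mem_class (ν : Stage7Numerics) (Kt : ℕ) {k : ℕ} (Z : Set (Site (F.P Kt) 0))
    (hkK : k + 1 ≤ (F.P Kt).m + (F.P Kt).K) (hM4 : 4 * (F.P Kt).L ≤ ν.M₁) (hdiv : side (F.P Kt).L ν.M₁ k ∣ (F.P Kt).sitesPerDir 0)
    (hε : 0 ≤ ν.εreg) {ρ'' : ℝ} (hsbU : ∀ V : GaugeField (F.P Kt) 0 (SU N), ‖coeField V - 1‖ ≤ ρ'' → SmallBelow (avOfRecord F N Kt) k V)
    (hερ : 6 * ((((F.P Kt).d - 1 : ℕ)) : ℝ) * (F.P Kt).L * ν.εreg ≤ ρ'')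
    {U₀ : GaugeField (F.P Kt) 0 (SU N)} (hU₀ : U₀ ∈ regMSCoPOfRecord F N ν Kt k (maxDomT ν.M₁ Z)) :
    ∀ (j : ℕ), 1 ≤ j → j ≤ k → ∀ y : Site (F.P Kt) j, embIter j y ∈ maxDomT ν.M₁ Z j → ∃ U' : GaugeField (F.P Kt) 0 (SU N),
      (∀ c : PBond (F.P Kt) j, (c.src = y ∨ c.tgt = y) → ∀ b₀ : PBond (F.P Kt) 0,
        (iterBlockOf j b₀.src = c.src ∨ iterBlockOf j b₀.src = c.tgt) → (iterBlockOf j b₀.tgt = c.src ∨ iterBlockOf j b₀.tgt = c.tgt) → U' b₀ = U₀ b₀) ∧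
      SmallBelow (avOfRecord F N Kt) k U' := by
  intro j hj1 hjk y hy
  have hk : k ≤ (F.P Kt).m + (F.P Kt).K := by omega
  have hjK : j ≤ (F.P Kt).m + (F.P Kt).K := hjk.trans hk
  have hM1 : 1 ≤ ν.M₁ := le_trans (by have := three_le_L (F.P Kt); omega) hM4
  set R : ℕ := 2 * (F.P Kt).L ^ j - 1 with hR
  set lo : Fin (F.P Kt).d → ℤ := fun κ => (((embIter j y) κ).val : ℤ) - (R : ℤ) with hlo
  set hi : Fin (F.P Kt).d → ℤ := fun κ => (((embIter j y) κ).val : ℤ) + (R : ℤ) + 2 with hhi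
  have hq : 1 ≤ (F.P Kt).L ^ j := Nat.one_le_pow _ _ (F.P Kt).L_pos
  -- the box plaquettes sit in the class's level-`(j−1)` set (no word: `x₀ = x = ι_j y`)
  have hfitR : 0 + R + 3 ≤ (F.P Kt).L ^ (j - 1) * ν.M₁ := by
    obtain ⟨i, rfl⟩ : ∃ i, j = i + 1 := ⟨j - 1, by omega⟩
    rw [Nat.add_sub_cancel, hR]
    have h4A : 4 * (F.P Kt).L ^ (i + 1) ≤ (F.P Kt).L ^ i * ν.M₁ :=
      calc 4 * (F.P Kt).L ^ (i + 1) = (F.P Kt).L ^ i * (4 * (F.P Kt).L) := by ring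
        _ ≤ (F.P Kt).L ^ i * ν.M₁ := Nat.mul_le_mul_left _ hM4
    have hi1 : 1 ≤ (F.P Kt).L ^ (i + 1) := Nat.one_le_pow _ _ (F.P Kt).L_pos
    omega
  have hplaqs : (boxPlaqs lo hi : Set (Plaq (F.P Kt) 0)) ⊆
      B8Eq17ClassAkV1.plaqsOf (topSeq (suppDomOfRecord F ν Kt (maxDomT ν.M₁ Z)) (maxDomT ν.M₁ Z) (j - 1)) :=
    boxPlaqs_subset_plaqsOf_topSeq_pred ν Kt hj1 hjk hM1 hdiv Z hy (rfl : walkEnd (embIter j y) [] = embIter j y) (by simp) hfitR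
  -- box side `4Lʲ ≤ 6Lʲ − 4 < 2L^{m+K}`, budget
  have hnb : ∀ κ, hi κ ≤ lo κ + ((6 * (F.P Kt).L ^ j - 4 : ℕ) : ℕ) := fun κ => by
    simp only [hlo, hhi, hR]
    have h2 : 2 ≤ (F.P Kt).L ^ j :=
      le_trans (by norm_num : 2 ≤ 3) (le_trans (three_le_L (F.P Kt)) (Nat.le_self_pow (by omega) _))
    omega
  have hnN : 6 * (F.P Kt).L ^ j - 4 < (F.P Kt).sitesPerDir 0 := towerBox_lt_sitesPerDir (F.P Kt) hkK hjk
  have hbudget : ((((F.P Kt).d - 1 : ℕ)) : ℝ) * ((6 * (F.P Kt).L ^ j - 4 : ℕ) : ℕ) * (ν.εreg * (F.P Kt).eta (j - 1) ^ 2) ≤ ρ'' := by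
    refine le_trans ?_ hερ
    have hside := boxSide_mul_eta_sq_le (F.P Kt) hj1
    calc ((((F.P Kt).d - 1 : ℕ)) : ℝ) * ((6 * (F.P Kt).L ^ j - 4 : ℕ) : ℕ) * (ν.εreg * (F.P Kt).eta (j - 1) ^ 2)
        = ((((F.P Kt).d - 1 : ℕ)) : ℝ) * ((((6 * (F.P Kt).L ^ j - 4 : ℕ) : ℝ) * (F.P Kt).eta (j - 1) ^ 2) * ν.εreg) := by ring
      _ ≤ ((((F.P Kt).d - 1 : ℕ)) : ℝ) * ((6 * ((F.P Kt).L : ℝ)) * ν.εreg) := by gcongr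
      _ = 6 * ((((F.P Kt).d - 1 : ℕ)) : ℝ) * (F.P Kt).L * ν.εreg := by ring
  obtain ⟨U', hU', hsb'⟩ := exists_boxProxy_of_mem_class ν Kt hk Z hnb hnN (by omega : j - 1 ≤ k) hplaqs hε hU₀ hsbU hbudget
  exact ⟨U', fun c hc b₀ hs _ => hU' b₀ (mem_boxBonds_of_block_row hjK y c hc b₀ hs), hsb'⟩

end Summit.QuantumFields.YangMills.BalabanUVNodes.N12SiteProxiesOfClass

end
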